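import Summits.QuantumFields.YangMills.Theses.StaticSourceWitness
import Summits.QuantumFields.YangMills.Theorems.BalabanLadderNTConjugateResponse
import Summits.QuantumFields.YangMills.Theorems.LangevinControlUVOSLegsFromFemtoAndGapStubCollar
import Literature.MathematicalPhysics.QuantumLattice.WilsonLoopsProofs
import HarnessLib

/-!
# Route `StaticSourceWitness`, item `Assembly` (stmt-QuantumFields-25288) — CLOSED

`theorem staticSourceWitness_assembly_proof : Summit.QuantumFields.YangMills.Theses.StaticSourceWitness.Assembly`,
i.e. `StaticSourceResponse → FarMirrorLoopCeiling → MirrorDefectVanishes → SkewAtResponseUnit → BalabanLadder.NT`.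

The one analytic input is the torus PROJECTIVE Gram (reflection-positivity Cauchy–Schwarz) inequality of the tree,
`NT.Reflection.sq_cov_negReflect_le_odd_pos` (Fröhlich–Israel–Lieb–Simon 1978 Thm 2.1), read through the periodic
lift exactly as in the kernel-checked `GradientFlowWitness.closes`:
`Cov_T(w∘Θ₀, Ṽ)² ≤ (E_T[(w∘Θ₀)·w] − E_T[w]²) · MF_β(v)` for the far-mirror Wilson loop `w` of `StaticSourceResponse`
and the smeared action density `Ṽ`; with the response `c₁E_T[w] ≤ |Cov_T(w∘Θ₀, Ṽ)|` and the projective ceiling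
`E_T[(w∘Θ₀)w] − E_T[w]² ≤ C₂E_T[w]²` of `FarMirrorLoopCeiling` this gives the bare mirror floor
`MF_β(v) ≥ c₁²/max(C₂,1)` (STEP A, `bare`), hence the pin of the shared defect item `MirrorDefectVanishes`, a femto
radius `ℓ₃`, and — re-running STEP A inside `min(ℓ₂, ℓ₃)` — clause (i) of `LowerBounds`; clause (ii) is the
declared residual `SkewAtResponseUnit`.

* §1 support bookkeeping for the rectangular loop: the edges under the darts of `rectWalk x i j R T` are based in
  the rectangle `x + [0,R]eᵢ + [0,T]eⱼ` (`dartStep_fst_mem_rect`), so a far-mirror window loop reads links based at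
  times in `[0, L−1]`;
* §2 the assembly.

R3/RECORD framing: route glue only — `StaticSourceResponse` (transmutation wall), `FarMirrorLoopCeiling`,
`MirrorDefectVanishes` and the residual stay OPEN; NT and a fortiori the Yang–Mills mass gap are NOT proved here.
Refs: Fröhlich–Israel–Lieb–Simon 1978 Thm 2.1; Osterwalder–Seiler 1978 §2; Seiler LNP 159 §2 (Wilson loops);
planner plan `assembly_plan_25288.md` (evidence on the item).
-/

set_option autoImplicit false

noncomputable section

open scoped SchwartzMap
open MeasureTheory Filter Topology SimpleGraph
open Literature.MathematicalPhysics.QuantumFieldTheory Literature.MathematicalPhysics.QuantumLattice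
open Literature.Probability.LatticeModels
open Summit.QuantumFields.YangMills.Cruxes.OSLegsFromFemtoAndGap.DlrCollarTransfer

namespace Summit.QuantumFields.YangMills.Theorems.StaticSourceWitness

/-! ## §1 The edges of a rectangular loop -/

/-- The edges under the darts of the straight walk `lineWalk i n x` are `(x + m·eᵢ, i)`, `m < n`. [folklore] -/
theorem dartStep_fst_of_mem_darts_lineWalk {d : ℕ} (i : Fin d) :
    ∀ (n : ℕ) (x : Site d) {e : (zdGraph d).Dart}, e ∈ (lineWalk i n x).darts →
      ∃ m : ℕ, m < n ∧ (dartStep e).1 = (x + Pi.single i (m : ℤ), i)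
  | 0, x, e, he => by simp [lineWalk] at he
  | n + 1, x, e, he => by
    simp only [lineWalk, Walk.darts_cons, Walk.darts_copy, List.mem_cons] at he
    rcases he with rfl | he
    · exact ⟨0, Nat.succ_pos n, by rw [dartStep_add_single]; simp⟩
    · obtain ⟨m, hm, hme⟩ := dartStep_fst_of_mem_darts_lineWalk i n _ he
      refine ⟨m + 1, by omega, ?_⟩
      rw [hme, add_assoc, ← Pi.single_add]
      push_cast
      rw [add_comm (1 : ℤ)]

/-- **The edges of the rectangular loop lie in its rectangle**: every edge under a dart of `rectWalk x i j R T` is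
based at `x + a·eᵢ + b·eⱼ` with `a ≤ R`, `b ≤ T`. [folklore] -/
theorem dartStep_fst_mem_rect {d : ℕ} (x : Site d) (i j : Fin d) (R T : ℕ) {e : (zdGraph d).Dart}
    (he : e ∈ (rectWalk x i j R T).darts) :
    ∃ a b : ℕ, a ≤ R ∧ b ≤ T ∧ (dartStep e).1.1 = x + Pi.single i (a : ℤ) + Pi.single j (b : ℤ) := by
  simp only [rectWalk, Walk.darts_append, Walk.darts_copy, Walk.darts_reverse, List.mem_append,
    List.mem_reverse, List.mem_map] at he
  rcases he with he | he | ⟨e, he, rfl⟩ | ⟨e, he, rfl⟩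
  · obtain ⟨m, hm, h⟩ := dartStep_fst_of_mem_darts_lineWalk i R x he
    exact ⟨m, 0, hm.le, Nat.zero_le _, by rw [h]; simp⟩
  · obtain ⟨m, hm, h⟩ := dartStep_fst_of_mem_darts_lineWalk j T _ he
    exact ⟨R, m, le_rfl, hm.le, by rw [h]⟩
  · obtain ⟨m, hm, h⟩ := dartStep_fst_of_mem_darts_lineWalk i R _ he
    refine ⟨m, T, hm.le, le_rfl, ?_⟩
    rw [dartStep_symm, h]
    simp only
    abel
  · obtain ⟨m, hm, h⟩ := dartStep_fst_of_mem_darts_lineWalk j T x he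
    refine ⟨0, m, Nat.zero_le _, hm.le, ?_⟩
    rw [dartStep_symm, h]
    simp

/-- Coordinates of the edges of the rectangular loop: `x_k ≤ z_k ≤ x_k + R + T`. [folklore] -/
theorem dartStep_fst_coord_bounds {d : ℕ} (x : Site d) (i j : Fin d) (R T : ℕ) {e : (zdGraph d).Dart}
    (he : e ∈ (rectWalk x i j R T).darts) (k : Fin d) :
    x k ≤ (dartStep e).1.1 k ∧ (dartStep e).1.1 k ≤ x k + R + T := by
  obtain ⟨a, b, ha, hb, h⟩ := dartStep_fst_mem_rect x i j R T he
  rw [h]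
  simp only [Pi.add_apply, Pi.single_apply]
  split_ifs <;> constructor <;> omega

/-- **Window of a far-mirror loop.**  If `0 ≤ x₀` and `x₀ + R + T + 2 ≤ L`, every link of the Wilson loop
`rectWalk x i j R T` is based at a time in `[0, L−1]` (the support finset of `isCylinder_wilsonLoopObs`). [folklore] -/
theorem rectWalk_support_window (x : Site 4) (i j : Fin 4) (R T : ℕ) (L : ℕ) (hx : 0 ≤ x 0)
    (hxL : x 0 + R + T + 2 ≤ (L : ℤ)) :
    ∀ e ∈ ((rectWalk x i j R T).darts.map fun e => (dartStep e).1).toFinset, 0 ≤ e.1 0 ∧ e.1 0 + 1 ≤ (L : ℤ) := by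
  intro e he
  rw [List.mem_toFinset, List.mem_map] at he
  obtain ⟨e', he', rfl⟩ := he
  have h := dartStep_fst_coord_bounds x i j R T he' 0
  constructor <;> omega

end Summit.QuantumFields.YangMills.Theorems.StaticSourceWitness

/-! ## §2 The assembly -/

namespace Summit.QuantumFields.YangMills.Theorems

open Summit.QuantumFields.YangMills.Theorems.StaticSourceWitness

/-- **Route `StaticSourceWitness`, item `Assembly` (stmt-QuantumFields-25288):**
`StaticSourceResponse → FarMirrorLoopCeiling → MirrorDefectVanishes → SkewAtResponseUnit → BalabanLadder.NT`.
STEP A (`bare`): at every femto radius `ℓ ≤ ℓ₂` the static-source response and the projective loop ceiling give a bare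
mirror floor `MF_β(v) ≥ c₁²/max(C₂,1)` by the Gram inequality `NT.Reflection.sq_cov_negReflect_le_odd_pos` and the
positivity `ConjugateResponse.cov_negReflect_self_nonneg` (both via the periodic lift: continuity, boundedness,
cylinder supports of the far-mirror Wilson loop and of the smeared density in the window `[0, L−1]`).  STEP B: the
floor at `ℓ₂` is the pin of `MirrorDefectVanishes`, which returns `ℓ₃`; the floor at `min(ℓ₂, ℓ₃)` and the defect
bound with `η = ε/2` give clause (i) of `LowerBounds`.  STEP C: clause (ii) is the residual.  R3/RECORD framing:
route glue — NT and the Yang–Mills mass gap are NOT proved here. [cite: FrohlichIsraelLiebSimon1978, Thm. 2.1] -/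
theorem staticSourceWitness_assembly_proof :
    Summit.QuantumFields.YangMills.Theses.StaticSourceWitness.Assembly := by
  unfold Summit.QuantumFields.YangMills.Theses.StaticSourceWitness.Assembly
  intro h₁ h₂ h₃ h₄ G _ _ _ _ hG
  letI : MeasurableSpace G := borel G
  haveI : BorelSpace G := ⟨rfl⟩
  obtain ⟨r, a, ha, ha0, hresp⟩ := h₁ G hG
  haveI := r.secondCountableTopology
  have hii := h₄ G hG r a ha ha0 hresp
  obtain ⟨ℓ₂, C₂, β₆, hℓ₂, hC⟩ := h₂ G hG r a ha ha0 hresp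
  let E := Cruxes.OSLegsFromFemtoAndGap.DlrCollarTransfer.torusE G r
  let θ : LGConfig 4 G → LGConfig 4 G := cfgReflect
  let Vs : SchwartzMap (EuclideanSpace ℝ (Fin 4)) ℝ → ℝ → ℕ → LGConfig 4 G → ℝ := fun v β L U =>
    ∑ y ∈ box 4 L, v (a β • siteToE y) * dens G r y U
  let MF : SchwartzMap (EuclideanSpace ℝ (Fin 4)) ℝ → ℝ → ℕ → ℝ := fun v β L =>
    E β L (fun V => Vs v β L (θ V) * Vs v β L V) - E β L (Vs v β L) ^ 2
  obtain ⟨βa, hβa⟩ : ∃ βa : ℝ, ∀ β, βa ≤ β → a β ≤ 1 :=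
    Filter.eventually_atTop.mp (ha0.eventually (eventually_le_nhds one_pos))
  -- STEP A: bare mirror floor at every femto radius inside the ceiling window.
  have bare : ∀ ℓ : ℝ, 0 < ℓ → ℓ ≤ ℓ₂ → ∃ (v : SchwartzMap (EuclideanSpace ℝ (Fin 4)) ℝ) (ε₀ β₀ Λ₀ : ℝ),
      tsupport (v : EuclideanSpace ℝ (Fin 4) → ℝ) ⊆ {y | 0 < y 0} ∧
      tsupport (v : EuclideanSpace ℝ (Fin 4) → ℝ) ⊆ Metric.closedBall 0 ℓ ∧ 0 < ε₀ ∧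
      ∀ β : ℝ, β₀ ≤ β → ∀ L : ℕ, Λ₀ ≤ a β * L → ε₀ ≤ MF v β L := by
    intro ℓ hℓ hℓ₂'
    obtain ⟨v, c₁, β₅, Λ₅, hvp, hvb, -, hc₁, hF⟩ := hresp ℓ hℓ
    refine ⟨v, c₁ ^ 2 / max C₂ 1, max (max β₅ β₆) (max βa 0), max Λ₅ (ℓ + 3), hvp, hvb, by positivity, ?_⟩
    intro β hβ L hL
    simp only [max_le_iff] at hβ hL
    have ha1 : a β ≤ 1 := hβa β hβ.2.1
    have haβ : 0 < a β := ha β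
    obtain ⟨x, i, j, R, T, hij, hR, hT, hRT, hwin', hxL, hEw, hRsp⟩ := hF β hβ.1.1 L hL.1
    have hL1 : 1 ≤ L := by
      have : (1 : ℤ) ≤ L := by omega
      exact_mod_cast this
    have hceil := hC β hβ.1.2 L x i j R T hij hR hT hRT (hwin'.trans hℓ₂') hxL hEw
    -- the Wilson loop: continuous, cylinder in the window
    let W : LGConfig 4 G → ℝ := wilsonLoopObs (fun g => (r.ρ g).trace.re) (rectWalk x i j R T)
    have hχ : Continuous fun g : G => (r.ρ g).trace.re :=
      Complex.continuous_re.comp (r.continuous.matrix_trace)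
    have hWc : Continuous W := continuous_wilsonLoopObs hχ _
    have hWS := isCylinder_wilsonLoopObs (fun g : G => (r.ρ g).trace.re) (rectWalk x i j R T)
    have hSW := rectWalk_support_window x i j R T L (by omega) hxL
    -- the smeared density: continuous, cylinder in the window
    have hVc : Continuous (Vs v β L) :=
      continuous_finsetSum _ fun y _ => continuous_const.mul (Cruxes.OSLegsFromFemtoAndGap.DlrCollarTransfer.continuous_dens r y)
    have hwin : ∀ y : Fin 4 → ℤ, v (a β • siteToE y) ≠ 0 → 1 ≤ y 0 ∧ y 0 + 3 ≤ (L : ℤ) := by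
      intro y hy
      have hm : a β • siteToE y ∈ tsupport (v : EuclideanSpace ℝ (Fin 4) → ℝ) :=
        subset_tsupport _ (Function.mem_support.2 hy)
      have h0 : (a β • siteToE y) 0 = a β * (y 0 : ℝ) := by simp [siteToE_apply]
      have hp : 0 < a β * (y 0 : ℝ) := by simpa only [Set.mem_setOf_eq, h0] using hvp hm
      have hy0 : 0 < (y 0 : ℝ) := (mul_pos_iff_of_pos_left haβ).mp hp
      have h2 : ‖(a β • siteToE y) 0‖ ≤ ‖a β • siteToE y‖ := PiLp.norm_apply_le _ _
      rw [h0, Real.norm_eq_abs, abs_of_pos hp] at h2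
      have h1 : ‖a β • siteToE y‖ ≤ ℓ := mem_closedBall_zero_iff.mp (hvb hm)
      have hy3 : (y 0 : ℝ) + 3 ≤ (L : ℝ) := le_of_mul_le_mul_left (by nlinarith [hL.2]) haβ
      have hy1 : (0 : ℤ) < y 0 := by exact_mod_cast hy0
      exact ⟨by omega, by exact_mod_cast hy3⟩
    let SV : Finset (Literature.MathematicalPhysics.QuantumLattice.ZdEdge 4) := ((box 4 L).filter fun y => 1 ≤ y 0 ∧ y 0 + 3 ≤ (L : ℤ)).biUnion
      fun y => r.curvature.supp.image fun e => (e.1 - -y, e.2)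
    have hSV : ∀ e ∈ SV, 0 ≤ e.1 0 ∧ e.1 0 + 1 ≤ (L : ℤ) := by
      intro e he
      obtain ⟨y, hy, he'⟩ := Finset.mem_biUnion.1 he
      have hw := (Finset.mem_filter.1 hy).2
      have hn := Cruxes.OSLegsFromFemtoAndGap.DlrCollarTransfer.near_of_mem_supp_dens r he' 0
      constructor <;> omega
    have hVS : IsCylinder (Vs v β L) SV := by
      intro U U' hUU'
      refine Finset.sum_congr rfl fun y hy => ?_
      by_cases hvy : v (a β • siteToE y) = 0
      · simp only [hvy, zero_mul]
      · congr 1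
        exact Cruxes.OSLegsFromFemtoAndGap.DlrCollarTransfer.isCylinder_dens r y (fun e he => hUU' e
          (Finset.mem_coe.2 (Finset.mem_biUnion.2 ⟨y, Finset.mem_filter.2 ⟨hy, hwin y hvy⟩, Finset.mem_coe.1 he⟩)))
    -- reflection positivity on the odd torus: Gram inequality and positivity of the mirror form
    have hpW := Cruxes.NT.MarkovMirror.dependsOn_posHalf_of_window (G := G) L hWS hSW
    have hpV := Cruxes.NT.MarkovMirror.dependsOn_posHalf_of_window (G := G) L hVS hSV
    have hWm := (hWc.comp (continuous_torusLift (d := 4) (G := G) (2 * L + 1))).measurable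
    have hVm := (hVc.comp (continuous_torusLift (d := 4) (G := G) (2 * L + 1))).measurable
    have hbd : ∀ F : LGConfig 4 G → ℝ, Continuous F →
        ∃ K : ℝ, ∀ U : GaugeConfig 4 (2 * L + 1) G, |F (torusLift (2 * L + 1) U)| ≤ K := by
      intro F hFc
      obtain ⟨K, hK⟩ := isCompact_univ.exists_bound_of_continuousOn
        ((hFc.comp (continuous_torusLift (d := 4) (G := G) (2 * L + 1))).continuousOn)
      exact ⟨K, fun U => by simpa only [Function.comp, Real.norm_eq_abs] using hK U (Set.mem_univ U)⟩
    have gram := Cruxes.NT.Reflection.sq_cov_negReflect_le_odd_pos (d := 4) r.ρ (S := L) rfl hL1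
      r.continuous hβ.2.2 hWm hVm (hbd _ hWc) (hbd _ hVc) hpW hpV
    have pos := Cruxes.NT.ConjugateResponse.cov_negReflect_self_nonneg r.ρ hL1 r.continuous hβ.2.2
      hVm (hbd _ hVc) hpV
    simp only [Function.comp_def, torusLift_negReflect] at gram pos
    change (E β L (fun U => W (θ U) * Vs v β L U) - E β L W * E β L (Vs v β L)) ^ 2 ≤
      (E β L (fun U => W (θ U) * W U) - E β L W ^ 2) * MF v β L at gram
    change 0 ≤ MF v β L at pos
    change 0 < E β L W at hEw
    change c₁ * E β L W ≤ |E β L (fun U => W (θ U) * Vs v β L U) - E β L W * E β L (Vs v β L)| at hRsp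
    change E β L (fun U => W (θ U) * W U) - E β L W ^ 2 ≤ C₂ * E β L W ^ 2 at hceil
    -- arithmetic: c₁² E[w]² ≤ Cov² ≤ (E[(w∘θ)w] − E[w]²)·MF ≤ max(C₂,1)·E[w]²·MF
    have hmax : 0 < max C₂ 1 := lt_of_lt_of_le one_pos (le_max_right _ _)
    have hsq : (c₁ * E β L W) ^ 2 ≤
        (E β L (fun U => W (θ U) * Vs v β L U) - E β L W * E β L (Vs v β L)) ^ 2 := by
      calc (c₁ * E β L W) ^ 2 ≤ |E β L (fun U => W (θ U) * Vs v β L U) - E β L W * E β L (Vs v β L)| ^ 2 :=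
            pow_le_pow_left₀ (by positivity) hRsp 2
        _ = _ := sq_abs _
    have hceil' : E β L (fun U => W (θ U) * W U) - E β L W ^ 2 ≤ max C₂ 1 * E β L W ^ 2 :=
      hceil.trans (mul_le_mul_of_nonneg_right (le_max_left _ _) (sq_nonneg _))
    have hprod := mul_le_mul_of_nonneg_right hceil' pos
    have hkey : c₁ ^ 2 * E β L W ^ 2 ≤ (max C₂ 1 * MF v β L) * E β L W ^ 2 := by nlinarith
    have hkey' : c₁ ^ 2 ≤ max C₂ 1 * MF v β L := le_of_mul_le_mul_right hkey (by positivity)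
    rw [div_le_iff₀ hmax]
    linarith
  -- STEP B: clause (i) of LowerBounds from the bare floor (pin at radius ℓ₂) and the shared defect item.
  have hi : ∃ (v : SchwartzMap (EuclideanSpace ℝ (Fin 4)) ℝ) (ε β₅ Λ₅ : ℝ),
      tsupport (v : EuclideanSpace ℝ (Fin 4) → ℝ) ⊆ {y : EuclideanSpace ℝ (Fin 4) | 0 < y 0} ∧ 0 < ε ∧
      ∀ β : ℝ, β₅ ≤ β → ∀ L : ℕ, Λ₅ ≤ a β * L →
        ε ≤ Cruxes.OSLegsFromFemtoAndGap.DlrCollarTransfer.Q2 G r β L (a β) (thetaTest 4 v) v := by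
    obtain ⟨v₀, ε₀, β₀, Λ₀, hv₀, -, hε₀, hM₀⟩ := bare ℓ₂ hℓ₂ le_rfl
    obtain ⟨ℓ₃, hℓ₃, hdef⟩ := h₃ G hG r a ha ha0 ⟨v₀, ε₀, β₀, Λ₀, hv₀, hε₀, hM₀⟩
    obtain ⟨v, ε, β₁, Λ₁, hv, hvb, hε, hM⟩ := bare (min ℓ₂ ℓ₃) (lt_min hℓ₂ hℓ₃) (min_le_left _ _)
    obtain ⟨β₇, Λ₇, hD⟩ := hdef v hv (hvb.trans (Metric.closedBall_subset_closedBall (min_le_right _ _)))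
      (ε / 2) (by positivity)
    refine ⟨v, ε / 2, max β₁ β₇, max Λ₁ Λ₇, hv, by positivity, ?_⟩
    intro β hβ L hL
    have h1 := hM β ((le_max_left _ _).trans hβ) L ((le_max_left _ _).trans hL)
    have h2 : |Cruxes.OSLegsFromFemtoAndGap.DlrCollarTransfer.Q2 G r β L (a β) (thetaTest 4 v) v - MF v β L| ≤
        ε / 2 := hD β ((le_max_right _ _).trans hβ) L ((le_max_right _ _).trans hL)
    rw [abs_le] at h2
    linarith [h2.1, h2.2]
  -- STEP C: the declared residual supplies clause (ii).
  exact ⟨r, a, ha, ha0, And.intro hi hii⟩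

end Summit.QuantumFields.YangMills.Theorems

end
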